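import Mathlib.Analysis.Calculus.ContDiff.Bounds
import Mathlib.Analysis.Calculus.Deriv.Mul
import Mathlib.Analysis.Calculus.Deriv.Add
import Mathlib.Analysis.Calculus.Deriv.Comp
import Mathlib.Algebra.BigOperators.NatAntidiagonal
import Mathlib.Data.Nat.Choose.Bounds
import HarnessLib

/-!
# Feldman–Salmhofer–Trubowitz IV — Lemma 3 (the norm lemma of §2.2: radial norms and products) — PROOF

J. Feldman, M. Salmhofer, E. Trubowitz, *An inversion theorem in Fermi surface theory*, Comm. Pure
Appl. Math. **53** (2000) 1350–1384 = arXiv:math-ph/0001031 [FeldmanSalmhoferTrubowitz2000]; render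
`paper:arxiv-math-ph_0001031` (`lit read`), locators `p.N:Ln` = chunk `pNNNN.txt`, line `n` (stable
locators: "§2.2", "Lemma 3").  Theorem-side companion of the FROZEN statement file
`FermiRG/FSTInversion.lean` (optional DAG row `FSTinv.L1-3`, its L3 part, of the `gate-hubbard-kl`
typer wave).  No `sorry`, no definition, no named fact (net fact debt 0): theorems only.

## The printed statement (§2.2, p.6:L143–207 and p.7:L1–5)

> Let `‖·‖_k` be the seminorm `‖F‖_k = Σ_{|α|=k} sup_p |∂^α F(p)|` and `|F|_k = Σ_{l=0}^k ‖F‖_l`.  It does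
> not matter whether we use the norm in Cartesian or polar coordinates since the two are equivalent.
> We define the radial norms for `p ≥ 1` as `|F|_{p,r} = |F|_{p−1} + ‖∂_r F̄‖_{p−1}` and denote the
> angular norms for `p ≥ 0` as `|F|_{p,θ}`. In the latter norms, all derivatives are taken in the
> `θ`–directions.
>
> **Lemma 3.** (i) `|F|_{p,r} ≤ |F|_{p+1}`.  (ii) For all `e ∈ B_ε^{(2)}(E)`, `∂_r ℓ_e F = 0`, and
> `|ℓ_e F|_{p,r} = |ℓ_e F|_{p−1} = |ℓ_e F|_{p−1,θ}`.  (iii) `|FG|_p ≤ 2^p |F|_p |G|_p`,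
> `|FG|_p ≤ ‖F‖₀‖G‖_p + ‖F‖_p‖G‖₀ + 2^{p+1} |F|_{p−1} |G|_{p−1}`.
> (iv) `|FG|_{p+1,r} ≤ 2^{p+2} |F|_p|G|_p + ‖∂_rF‖_p‖G‖₀ + ‖F‖₀‖∂_r G‖_p ≤ 2^{p+2}(|F|_{p+1,r}|G|_p + |F|_p|G|_{p+1,r})`.
>
> *Proof.* The first statement is an immediate consequence of `‖∂_r F‖_p ≤ ‖F‖_{p+1}`. The second
> statement is an immediate consequence of the observation that the localization map `ℓ_e` does not
> depend on `r`. For the third and fourth statements, use the Leibniz rule and that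
> `Π (α_k choose β_k) ≤ (p choose q)` … to prove that `‖FG‖_p ≤ Σ_{q=0}^p (p choose q) ‖F‖_q ‖G‖_{p−q}` and
> `‖∂_r(FG)‖_p ≤ Σ_{q=0}^p (p choose q)(‖∂_rF‖_q ‖G‖_{p−q} + ‖F‖_{p−q} ‖∂_r G‖_q)`.

## How the norms are typed (read this first)

By the print's own remark the Cartesian/polar and coordinate/operator choices of the norms are
equivalent; as in `FermiRG/FST3NormBridge.lean` (row `FSTinv.L3iii`, where (iii)'s first inequality is
typed WITHOUT the summation estimate `2^p`) we use OPERATOR norms of Fréchet derivatives: for `F` on a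
real normed space `X` (the polar chart `ℝ × S^{d−1}` in coordinates, or `ℝ^d`) with values in a
commutative normed `ℝ`-algebra `𝔸` (`ℝ` or `ℂ` in the paper), `‖F‖_j` is realised by any bound
`a j ≥ sup_x ‖D^j F(x)‖` — a PROFILE `a : ℕ → ℝ` with `‖iteratedFDeriv ℝ j F x‖ ≤ a j` — and
`|F|_p ≤ Σ_{j ≤ p} a j`.  The radial derivative is the derivative along the constant unit radial field
of the chart, `∂_r F := fun x => fderiv ℝ F x u` for a fixed vector `u` (`‖u‖ ≤ 1`), with its own
profile `ar`.  Every statement is proved POINTWISE in `x` for the derivative norms of the product and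
with the profiles on the right — i.e. exactly "`sup ≤ bound`" once `a j = ‖F‖_j`; suprema themselves
(and their `sSup` junk) are not introduced.  Proved:
* (i) `norm_iteratedFDeriv_radialDeriv_le`: `‖D^j(∂_r F)(x)‖ ≤ ‖u‖ ‖D^{j+1}F(x)‖` ("`‖∂_r F‖_p ≤ ‖F‖_{p+1}`"),
  whence `|F|_{p,r} ≤ |F|_p ≤ |F|_{p+1}` (`radialNorm_le`);
* (ii) `fderiv_apply_eq_zero_of_invariant`, `iteratedFDeriv_eq_of_invariant`,
  `iteratedFDeriv_cons_eq_zero_of_invariant`: a function that "does not depend on `r`" (invariant under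
  `x ↦ x + t•u`) has `∂_r = 0`, all its derivatives are `r`-independent, and every derivative with an
  `r`-slot (first slot; the other slots by the symmetry of higher derivatives, not restated) vanishes —
  the content of `|ℓ_e F|_{p,r} = |ℓ_e F|_{p−1} = |ℓ_e F|_{p−1,θ}` (the localisation map `ℓ_e` itself,
  `(ℓ_e F)(r,θ) = F(r_F(e,θ),θ)`, is such a function by construction; it is not re-defined here);
* (iii) `sum_norm_iteratedFDeriv_mul_le` (`|FG|_p ≤ 2^p |F|_p |G|_p`, via Mathlib's Leibniz bound
  `norm_iteratedFDeriv_mul_le` = the print's "`‖FG‖_p ≤ Σ_q (p choose q) ‖F‖_q ‖G‖_{p−q}`", `(n choose q) ≤ 2^n ≤ 2^p`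
  and the pair count `sum_sum_range_sub_le`) and `sum_norm_iteratedFDeriv_mul_le'` (the refined form,
  stated at `p+1`: `|FG|_{p+1} ≤ ‖F‖₀‖G‖_{p+1} + ‖F‖_{p+1}‖G‖₀ + 2^{p+2}|F|_p|G|_p`);
* (iv) `fderiv_mul_apply_radial` (`∂_r(FG) = (∂_rF)G + F ∂_rG`), `norm_iteratedFDeriv_radialDeriv_mul_le`
  (the print's second Leibniz display, top order, extreme terms split off) and `radialNorm_mul_le` (both
  printed inequalities of (iv)).

Typer lint: no `instance`, no `notation`, no attribute changes; no definitions.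
-/

noncomputable section

open scoped BigOperators
open Finset

namespace Literature.MathematicalPhysics.QuantumLattice.FermiRG

namespace FST4

variable {X : Type*} [NormedAddCommGroup X] [NormedSpace ℝ X]
variable {𝔸 : Type*} [NormedCommRing 𝔸] [NormedAlgebra ℝ 𝔸]

/-! ### (i) `‖∂_r F‖_p ≤ ‖F‖_{p+1}`, hence `|F|_{p,r} ≤ |F|_{p+1}` -/

/-- **Lemma 3 (i), the derivative count**: "`‖∂_r F‖_p ≤ ‖F‖_{p+1}`" (p.6:L192–193) — the `j`-th
derivative of the radial derivative `∂_r F = D F(·) u` is bounded by the `(j+1)`-st derivative of `F`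
(times `‖u‖ ≤ 1` for the unit radial field).
[cite: FeldmanSalmhoferTrubowitz2000, Lemma 3 (i) §2.2 p.6:L167; proof p.6:L192-193] -/
theorem norm_iteratedFDeriv_radialDeriv_le {F : X → 𝔸} {n : ℕ} (hF : ContDiff ℝ n F) {j : ℕ}
    (hj : j + 1 ≤ n) (u : X) (x : X) :
    ‖iteratedFDeriv ℝ j (fun y => fderiv ℝ F y u) x‖ ≤ ‖u‖ * ‖iteratedFDeriv ℝ (j + 1) F x‖ := by
  have h1 : ContDiff ℝ j (fderiv ℝ F) := hF.fderiv_right (m := j) (by exact_mod_cast hj)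
  have h2 := norm_iteratedFDeriv_clm_apply_const (c := u) (h1.contDiffAt (x := x)) (n := j) le_rfl
  rw [norm_iteratedFDeriv_fderiv] at h2
  exact h2

/-- **Lemma 3 (i)**: "`|F|_{p,r} ≤ |F|_{p+1}`" (indeed `≤ |F|_p`): with a profile `a j ≥ ‖D^j F‖`
(`j ≤ p + 1`) and `‖u‖ ≤ 1`, the radial norm `|F|_{p,r} = |F|_{p−1} + ‖∂_rF‖_{p−1}` is bounded, at every
point and for the top radial term, by `Σ_{j ≤ p} a j ≤ Σ_{j ≤ p+1} a j` (stated at `p ≥ 1` as `p = q+1`: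
`Σ_{j ≤ q} a j`-part plus `‖D^q(∂_rF)(x)‖ ≤ Σ_{j ≤ q+1} a j ≤ Σ_{j ≤ q+2} a j`).
[cite: FeldmanSalmhoferTrubowitz2000, Lemma 3 (i) §2.2 p.6:L154-158, L167; proof p.6:L192-193] -/
theorem radialNorm_le {F : X → 𝔸} {q : ℕ} (hF : ContDiff ℝ (q + 1) F) {a : ℕ → ℝ}
    (ha : ∀ j ≤ q + 2, ∀ x, ‖iteratedFDeriv ℝ j F x‖ ≤ a j) {u : X} (hu : ‖u‖ ≤ 1) (x : X) :
    (∑ j ∈ range (q + 1), a j) + ‖iteratedFDeriv ℝ q (fun y => fderiv ℝ F y u) x‖ ≤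
        ∑ j ∈ range (q + 2), a j ∧
      ∑ j ∈ range (q + 2), a j ≤ ∑ j ∈ range (q + 3), a j := by
  have h1 := norm_iteratedFDeriv_radialDeriv_le hF (j := q) le_rfl u x
  have h2 : ‖iteratedFDeriv ℝ q (fun y => fderiv ℝ F y u) x‖ ≤ a (q + 1) :=
    h1.trans ((mul_le_of_le_one_left (norm_nonneg _) hu).trans (ha (q + 1) (by omega) x))
  refine ⟨?_, ?_⟩
  · rw [sum_range_succ _ (q + 1)]
    linarith
  · rw [sum_range_succ _ (q + 2)]
    linarith [(norm_nonneg _).trans (ha (q + 2) le_rfl x)]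

/-! ### (ii) functions that do not depend on `r` -/

/-- **Lemma 3 (ii), first clause**: "`∂_r ℓ_e F = 0`" — "an immediate consequence of the observation
that the localization map `ℓ_e` does not depend on `r`" (p.6:L193–195): a function invariant under the
radial translations `x ↦ x + t•u` has vanishing radial derivative (no differentiability assumed: where
`H` is not differentiable the derivative is `0` by convention as well).
[cite: FeldmanSalmhoferTrubowitz2000, Lemma 3 (ii) §2.2 p.6:L169-174; proof p.6:L193-195] -/
theorem fderiv_apply_eq_zero_of_invariant {V : Type*} [NormedAddCommGroup V] [NormedSpace ℝ V]
    {H : X → V} {u : X} (hH : ∀ x (t : ℝ), H (x + t • u) = H x) (x : X) :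
    fderiv ℝ H x u = 0 := by
  by_cases hd : DifferentiableAt ℝ H x
  · have h1 : HasDerivAt (fun t : ℝ => x + t • u) ((1 : ℝ) • u) 0 :=
      ((hasDerivAt_id (0 : ℝ)).smul_const u).const_add x
    rw [one_smul] at h1
    have h2 : HasDerivAt (fun t : ℝ => H (x + t • u)) (fderiv ℝ H x u) 0 := by
      have h3 : HasFDerivAt H (fderiv ℝ H x) (x + (0 : ℝ) • u) := by
        rw [zero_smul, add_zero]; exact hd.hasFDerivAt
      exact h3.comp_hasDerivAt (0 : ℝ) h1
    have h5 : HasDerivAt (fun t : ℝ => H (x + t • u)) 0 0 := by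
      have h6 : (fun t : ℝ => H (x + t • u)) = fun _ => H x := funext fun t => hH x t
      rw [h6]
      exact hasDerivAt_const 0 (H x)
    exact h2.unique h5
  · rw [fderiv_zero_of_not_differentiableAt hd, zero_apply]

/-- **Lemma 3 (ii)**: all derivatives of an `r`-independent function are `r`-independent
(`D^k H(x + t•u) = D^k H(x)`). [cite: FeldmanSalmhoferTrubowitz2000, Lemma 3 (ii) §2.2 p.6:L169-174; proof p.6:L193-195] -/
theorem iteratedFDeriv_eq_of_invariant {V : Type*} [NormedAddCommGroup V] [NormedSpace ℝ V]
    {H : X → V} {u : X} (hH : ∀ x (t : ℝ), H (x + t • u) = H x) (k : ℕ) (x : X) (t : ℝ) :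
    iteratedFDeriv ℝ k H (x + t • u) = iteratedFDeriv ℝ k H x := by
  have h1 : (fun y => H (y + t • u)) = H := funext fun y => hH y t
  rw [← iteratedFDeriv_comp_add_right, h1]

/-- **Lemma 3 (ii), the norm identity** "`|ℓ_e F|_{p,r} = |ℓ_e F|_{p−1} = |ℓ_e F|_{p−1,θ}`": for an
`r`-independent `H` every derivative with a radial slot vanishes, `D^{k+1}H(x)(u, v₁, …, v_k) = 0` (first
slot; the radial profile is identically `0`, so the radial norm reduces to `|H|_{p−1}`, and only
`θ`-directions contribute — the angular norm; the remaining slots follow by the symmetry of `D^{k+1}H`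
and are not restated). [cite: FeldmanSalmhoferTrubowitz2000, Lemma 3 (ii) §2.2 p.6:L160-162, L169-174; proof p.6:L193-195] -/
theorem iteratedFDeriv_cons_eq_zero_of_invariant {V : Type*} [NormedAddCommGroup V]
    [NormedSpace ℝ V] {H : X → V} {u : X} (hH : ∀ x (t : ℝ), H (x + t • u) = H x) (k : ℕ)
    (x : X) (v : Fin k → X) :
    iteratedFDeriv ℝ (k + 1) H x (Fin.cons u v) = 0 := by
  rw [iteratedFDeriv_succ_apply_left, Fin.cons_zero, Fin.tail_cons]
  have h1 := fderiv_apply_eq_zero_of_invariant (iteratedFDeriv_eq_of_invariant hH k) x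
  rw [h1, zero_apply]

/-! ### (iii) the product estimates -/

/-- Pair count behind `2^p`: `Σ_{n ≤ p} Σ_{k ≤ n} f(k, n−k) ≤ Σ_{i ≤ p} Σ_{j ≤ p} f(i, j)` for `f ≥ 0`
(each pair `(i, j)` with `i + j ≤ p` occurs once on the left). [folklore] -/
private theorem sum_sum_range_sub_le {f : ℕ → ℕ → ℝ} {p : ℕ}
    (hf : ∀ i ≤ p, ∀ j ≤ p, 0 ≤ f i j) :
    ∑ n ∈ range (p + 1), ∑ k ∈ range (n + 1), f k (n - k) ≤
      ∑ i ∈ range (p + 1), ∑ j ∈ range (p + 1), f i j := by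
  have h1 : ∀ n, ∑ k ∈ range (n + 1), f k (n - k) = ∑ ij ∈ antidiagonal n, f ij.1 ij.2 :=
    fun n => (Nat.sum_antidiagonal_eq_sum_range_succ (fun i j => f i j) n).symm
  simp_rw [h1]
  rw [← sum_biUnion]
  · rw [← sum_product']
    apply sum_le_sum_of_subset_of_nonneg
    · intro ij hij
      rw [mem_biUnion] at hij
      obtain ⟨n, hn, hij⟩ := hij
      rw [HasAntidiagonal.mem_antidiagonal] at hij
      rw [mem_range] at hn
      rw [mem_product, mem_range, mem_range]
      omega
    · intro ij hij _
      rw [mem_product, mem_range, mem_range] at hij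
      exact hf _ (by omega) _ (by omega)
  · intro m _ n _ hmn
    exact disjoint_left.2 fun ij hm hn' => hmn (by
      rw [HasAntidiagonal.mem_antidiagonal] at hm hn'; omega)

/-- **Lemma 3 (iii)**: "`|FG|_p ≤ 2^p |F|_p |G|_p`" (p.6:L178) — from the Leibniz bound
"`‖FG‖_p ≤ Σ_{q=0}^p (p choose q) ‖F‖_q ‖G‖_{p−q}`" (p.6:L202–205; Mathlib `norm_iteratedFDeriv_mul_le`),
`(n choose q) ≤ 2^n ≤ 2^p` and the pair count: for profiles `a j ≥ ‖D^jF‖`, `b j ≥ ‖D^jG‖` (`j ≤ p`),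
at every point `Σ_{n ≤ p} ‖D^n(FG)(x)‖ ≤ 2^p (Σ_{i≤p} a i)(Σ_{j≤p} b j)`.
[cite: FeldmanSalmhoferTrubowitz2000, Lemma 3 (iii) §2.2 p.6:L176-181; proof p.6:L195-205] -/
theorem sum_norm_iteratedFDeriv_mul_le {F G : X → 𝔸} {p : ℕ} (hF : ContDiff ℝ p F)
    (hG : ContDiff ℝ p G) {a b : ℕ → ℝ} (ha : ∀ j ≤ p, ∀ x, ‖iteratedFDeriv ℝ j F x‖ ≤ a j)
    (hb : ∀ j ≤ p, ∀ x, ‖iteratedFDeriv ℝ j G x‖ ≤ b j) (x : X) :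
    ∑ n ∈ range (p + 1), ‖iteratedFDeriv ℝ n (fun y => F y * G y) x‖ ≤
      2 ^ p * ((∑ i ∈ range (p + 1), a i) * ∑ j ∈ range (p + 1), b j) := by
  have ha0 : ∀ i ≤ p, 0 ≤ a i := fun i hi => (norm_nonneg _).trans (ha i hi x)
  have hb0 : ∀ j ≤ p, 0 ≤ b j := fun j hj => (norm_nonneg _).trans (hb j hj x)
  have hterm : ∀ n ∈ range (p + 1), ‖iteratedFDeriv ℝ n (fun y => F y * G y) x‖ ≤
      ∑ k ∈ range (n + 1), 2 ^ p * (a k * b (n - k)) := by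
    intro n hn
    rw [mem_range] at hn
    refine (norm_iteratedFDeriv_mul_le hF hG x (n := n)
      (by exact_mod_cast Nat.lt_succ_iff.1 hn)).trans ?_
    refine sum_le_sum fun k hk => ?_
    rw [mem_range] at hk
    have hkp : k ≤ p := by omega
    have hnkp : n - k ≤ p := by omega
    have hchoose : (n.choose k : ℝ) ≤ 2 ^ p := by
      calc (n.choose k : ℝ) ≤ 2 ^ n := by exact_mod_cast Nat.choose_le_two_pow n k
        _ ≤ 2 ^ p := pow_le_pow_right₀ (by norm_num) (by omega)
    calc (n.choose k : ℝ) * ‖iteratedFDeriv ℝ k F x‖ * ‖iteratedFDeriv ℝ (n - k) G x‖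
        ≤ 2 ^ p * a k * b (n - k) := by
          gcongr
          · exact mul_nonneg (by positivity) (ha0 k hkp)
          · exact ha k hkp x
          · exact hb (n - k) hnkp x
      _ = 2 ^ p * (a k * b (n - k)) := by ring
  refine (sum_le_sum hterm).trans ?_
  simp_rw [← mul_sum]
  rw [sum_mul_sum]
  have key := sum_sum_range_sub_le (f := fun i j => a i * b j)
    fun i hi j hj => mul_nonneg (ha0 i hi) (hb0 j hj)
  exact mul_le_mul_of_nonneg_left key (by positivity)

/-- **The top-order Leibniz sum with the two extreme terms split off** (the step from the first to the
second form of (iii), p.6:L178–180): `‖D^{p+1}(FG)(x)‖ ≤ a₀ b_{p+1} + a_{p+1} b₀ + 2^{p+1}(Σ_{i≤p} a i)(Σ_{j≤p} b j)`.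
[cite: FeldmanSalmhoferTrubowitz2000, Lemma 3 (iii) §2.2 p.6:L176-181; proof p.6:L195-205] -/
theorem norm_iteratedFDeriv_mul_top_le {F G : X → 𝔸} {p : ℕ} (hF : ContDiff ℝ (p + 1) F)
    (hG : ContDiff ℝ (p + 1) G) {a b : ℕ → ℝ}
    (ha : ∀ j ≤ p + 1, ∀ x, ‖iteratedFDeriv ℝ j F x‖ ≤ a j)
    (hb : ∀ j ≤ p + 1, ∀ x, ‖iteratedFDeriv ℝ j G x‖ ≤ b j) (x : X) :
    ‖iteratedFDeriv ℝ (p + 1) (fun y => F y * G y) x‖ ≤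
      a 0 * b (p + 1) + a (p + 1) * b 0 +
        2 ^ (p + 1) * ((∑ i ∈ range (p + 1), a i) * ∑ j ∈ range (p + 1), b j) := by
  have ha0 : ∀ i ≤ p + 1, 0 ≤ a i := fun i hi => (norm_nonneg _).trans (ha i hi x)
  have hb0 : ∀ j ≤ p + 1, 0 ≤ b j := fun j hj => (norm_nonneg _).trans (hb j hj x)
  have hB : ∀ j ≤ p, b j ≤ ∑ j ∈ range (p + 1), b j := fun j hj =>
    single_le_sum (f := b) (fun i hi => hb0 i (by rw [mem_range] at hi; omega))
      (mem_range.2 (Nat.lt_succ_of_le hj))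
  have hBnn : 0 ≤ ∑ j ∈ range (p + 1), b j :=
    sum_nonneg fun j hj => hb0 j (by rw [mem_range] at hj; omega)
  -- termwise bound by a case-defined profile
  have hterm : ∀ k ∈ range (p + 2),
      ((p + 1).choose k : ℝ) * ‖iteratedFDeriv ℝ k F x‖ * ‖iteratedFDeriv ℝ (p + 1 - k) G x‖ ≤
        (if k = 0 then a 0 * b (p + 1) else if k = p + 1 then a (p + 1) * b 0
          else 2 ^ (p + 1) * (a k * ∑ j ∈ range (p + 1), b j)) := by
    intro k hk
    rw [mem_range] at hk
    rcases Nat.eq_zero_or_pos k with rfl | hk0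
    · rw [if_pos rfl, Nat.choose_zero_right, Nat.cast_one, one_mul]
      exact mul_le_mul (ha 0 (by omega) x) (hb (p + 1) le_rfl x) (norm_nonneg _) (ha0 0 (by omega))
    · rw [if_neg hk0.ne']
      by_cases hkp : k = p + 1
      · subst hkp
        rw [if_pos rfl, Nat.choose_self, Nat.cast_one, one_mul]
        calc ‖iteratedFDeriv ℝ (p + 1) F x‖ * ‖iteratedFDeriv ℝ (p + 1 - (p + 1)) G x‖
            ≤ a (p + 1) * b (p + 1 - (p + 1)) :=
              mul_le_mul (ha _ le_rfl x) (hb _ (by omega) x) (norm_nonneg _) (ha0 _ le_rfl)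
          _ = a (p + 1) * b 0 := by rw [Nat.sub_self]
      · rw [if_neg hkp]
        have hchoose : ((p + 1).choose k : ℝ) ≤ 2 ^ (p + 1) := by
          exact_mod_cast Nat.choose_le_two_pow (p + 1) k
        calc ((p + 1).choose k : ℝ) * ‖iteratedFDeriv ℝ k F x‖ * ‖iteratedFDeriv ℝ (p + 1 - k) G x‖
            ≤ 2 ^ (p + 1) * a k * ∑ j ∈ range (p + 1), b j := by
              gcongr
              · exact mul_nonneg (by positivity) (ha0 _ (by omega))
              · exact ha _ (by omega) x
              · exact (hb _ (by omega) x).trans (hB _ (by omega))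
          _ = 2 ^ (p + 1) * (a k * ∑ j ∈ range (p + 1), b j) := by ring
  have h1 := norm_iteratedFDeriv_mul_le hF hG x (n := p + 1) (by exact_mod_cast le_rfl)
  refine (h1.trans (sum_le_sum hterm)).trans ?_
  rw [sum_range_succ, sum_range_succ', if_pos rfl, if_neg (Nat.succ_ne_zero p), if_pos rfl]
  have hmid : ∑ k ∈ range p,
      (if k + 1 = 0 then a 0 * b (p + 1) else if k + 1 = p + 1 then a (p + 1) * b 0
        else 2 ^ (p + 1) * (a (k + 1) * ∑ j ∈ range (p + 1), b j)) ≤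
      2 ^ (p + 1) * ((∑ i ∈ range (p + 1), a i) * ∑ j ∈ range (p + 1), b j) := by
    rw [sum_congr rfl (g := fun k => 2 ^ (p + 1) * (a (k + 1) * ∑ j ∈ range (p + 1), b j))
      (fun k hk => by
        rw [mem_range] at hk
        rw [if_neg (Nat.succ_ne_zero k), if_neg (by omega)])]
    rw [← mul_sum, ← sum_mul]
    gcongr
    have h3 : ∑ i ∈ range (p + 1), a i = ∑ k ∈ range p, a (k + 1) + a 0 := sum_range_succ' a p
    rw [h3]
    linarith [ha0 0 (by omega)]
  linarith

/-- **Lemma 3 (iii), second form** (p.6:L179–180, stated at `p + 1`):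
"`|FG|_{p+1} ≤ ‖F‖₀‖G‖_{p+1} + ‖F‖_{p+1}‖G‖₀ + 2^{p+2}|F|_p|G|_p`" — at every point,
`Σ_{n ≤ p+1} ‖D^n(FG)(x)‖ ≤ a₀ b_{p+1} + a_{p+1} b₀ + 2^{p+2}(Σ_{i≤p} a i)(Σ_{j≤p} b j)`.
[cite: FeldmanSalmhoferTrubowitz2000, Lemma 3 (iii) §2.2 p.6:L176-181; proof p.6:L195-205] -/
theorem sum_norm_iteratedFDeriv_mul_le' {F G : X → 𝔸} {p : ℕ} (hF : ContDiff ℝ (p + 1) F)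
    (hG : ContDiff ℝ (p + 1) G) {a b : ℕ → ℝ}
    (ha : ∀ j ≤ p + 1, ∀ x, ‖iteratedFDeriv ℝ j F x‖ ≤ a j)
    (hb : ∀ j ≤ p + 1, ∀ x, ‖iteratedFDeriv ℝ j G x‖ ≤ b j) (x : X) :
    ∑ n ∈ range (p + 2), ‖iteratedFDeriv ℝ n (fun y => F y * G y) x‖ ≤
      a 0 * b (p + 1) + a (p + 1) * b 0 +
        2 ^ (p + 2) * ((∑ i ∈ range (p + 1), a i) * ∑ j ∈ range (p + 1), b j) := by
  have hF' : ContDiff ℝ p F := hF.of_le (by exact_mod_cast Nat.le_succ p)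
  have hG' : ContDiff ℝ p G := hG.of_le (by exact_mod_cast Nat.le_succ p)
  have hlow := sum_norm_iteratedFDeriv_mul_le hF' hG' (fun j hj => ha j (by omega))
    (fun j hj => hb j (by omega)) x
  have htop := norm_iteratedFDeriv_mul_top_le hF hG ha hb x
  rw [sum_range_succ]
  have hAB : 0 ≤ (∑ i ∈ range (p + 1), a i) * ∑ j ∈ range (p + 1), b j :=
    mul_nonneg
      (sum_nonneg fun i hi => (norm_nonneg _).trans (ha i (by rw [mem_range] at hi; omega) x))
      (sum_nonneg fun j hj => (norm_nonneg _).trans (hb j (by rw [mem_range] at hj; omega) x))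
  have h2p : (0 : ℝ) < 2 ^ p := pow_pos (by norm_num) p
  have e1 : (2 : ℝ) ^ (p + 1) = 2 * 2 ^ p := by ring
  have e2 : (2 : ℝ) ^ (p + 2) = 4 * 2 ^ p := by ring
  rw [e1] at htop
  rw [e2]
  nlinarith [mul_nonneg h2p.le hAB]

/-! ### (iv) the radial norm of a product -/

/-- **The radial Leibniz rule** `∂_r(FG) = (∂_r F) G + F (∂_r G)` (behind the print's second display,
p.6:L207–p.7:L5). [cite: FeldmanSalmhoferTrubowitz2000, Lemma 3 (iv) §2.2 p.6:L183-189; proof p.6:L207-p.7:L5] -/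
theorem fderiv_mul_apply_radial {F G : X → 𝔸} {x : X} (hF : DifferentiableAt ℝ F x)
    (hG : DifferentiableAt ℝ G x) (u : X) :
    fderiv ℝ (fun y => F y * G y) x u = fderiv ℝ F x u * G x + F x * fderiv ℝ G x u := by
  rw [fderiv_fun_mul hF hG]
  simp only [add_apply, smul_apply, smul_eq_mul]
  ring

/-- **Lemma 3 (iv), the top-order radial Leibniz estimate with the extreme terms split off**
("`‖∂_r(FG)‖_p ≤ Σ_q (p choose q)(‖∂_rF‖_q‖G‖_{p−q} + ‖F‖_{p−q}‖∂_rG‖_q)`", p.6:L207–p.7:L5, followed by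
`(p choose q) ≤ 2^p` and (i)): with profiles `a, b` (`j ≤ p`) for `F, G`, `ar, br` (`j ≤ p`) for
`∂_rF, ∂_rG`, and (i) in the form `ar j ≤ a (j+1)`, `br j ≤ b (j+1)` (`j < p`), at every point
`‖D^p ∂_r(FG)(x)‖ ≤ ar_p b₀ + a₀ br_p + 2^{p+1}(Σ_{i≤p} a i)(Σ_{j≤p} b j)`.
[cite: FeldmanSalmhoferTrubowitz2000, Lemma 3 (iv) §2.2 p.6:L183-189; proof p.6:L195-207, p.7:L1-5] -/
theorem norm_iteratedFDeriv_radialDeriv_mul_le {F G : X → 𝔸} {p : ℕ} {u : X}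
    (hF : ContDiff ℝ (p + 1) F) (hG : ContDiff ℝ (p + 1) G) {a b ar br : ℕ → ℝ}
    (ha : ∀ j ≤ p, ∀ x, ‖iteratedFDeriv ℝ j F x‖ ≤ a j)
    (hb : ∀ j ≤ p, ∀ x, ‖iteratedFDeriv ℝ j G x‖ ≤ b j)
    (har : ∀ j ≤ p, ∀ x, ‖iteratedFDeriv ℝ j (fun y => fderiv ℝ F y u) x‖ ≤ ar j)
    (hbr : ∀ j ≤ p, ∀ x, ‖iteratedFDeriv ℝ j (fun y => fderiv ℝ G y u) x‖ ≤ br j)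
    (har' : ∀ j < p, ar j ≤ a (j + 1)) (hbr' : ∀ j < p, br j ≤ b (j + 1)) (x : X) :
    ‖iteratedFDeriv ℝ p (fun y => fderiv ℝ (fun z => F z * G z) y u) x‖ ≤
      ar p * b 0 + a 0 * br p +
        2 ^ (p + 1) * ((∑ i ∈ range (p + 1), a i) * ∑ j ∈ range (p + 1), b j) := by
  -- regularity
  have hp1 : (p : WithTop ℕ∞) ≤ (p + 1 : ℕ) := by exact_mod_cast Nat.le_succ p
  have hF' : ContDiff ℝ p F := hF.of_le hp1
  have hG' : ContDiff ℝ p G := hG.of_le hp1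
  have hdF : ContDiff ℝ p (fun y => fderiv ℝ F y u) :=
    (hF.fderiv_right (m := p) (by exact_mod_cast le_rfl)).clm_apply contDiff_const
  have hdG : ContDiff ℝ p (fun y => fderiv ℝ G y u) :=
    (hG.fderiv_right (m := p) (by exact_mod_cast le_rfl)).clm_apply contDiff_const
  have h1 : ∀ y, DifferentiableAt ℝ F y := fun y => hF.differentiable (by simp) y
  have h2 : ∀ y, DifferentiableAt ℝ G y := fun y => hG.differentiable (by simp) y
  -- the radial Leibniz rule as an identity of functions
  have hsplit : (fun y => fderiv ℝ (fun z => F z * G z) y u) =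
      (fun y => fderiv ℝ F y u * G y) + fun y => F y * fderiv ℝ G y u := by
    funext y
    exact fderiv_mul_apply_radial (h1 y) (h2 y) u
  rw [hsplit, iteratedFDeriv_add_apply (hdF.mul hG').contDiffAt (hF'.mul hdG).contDiffAt]
  refine (norm_add_le _ _).trans ?_
  -- nonnegativity and single-term bounds
  have ha0 : ∀ i ≤ p, 0 ≤ a i := fun i hi => (norm_nonneg _).trans (ha i hi x)
  have hb0 : ∀ j ≤ p, 0 ≤ b j := fun j hj => (norm_nonneg _).trans (hb j hj x)
  have har0 : ∀ i ≤ p, 0 ≤ ar i := fun i hi => (norm_nonneg _).trans (har i hi x)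
  have hA : ∀ j ≤ p, a j ≤ ∑ i ∈ range (p + 1), a i := fun j hj =>
    single_le_sum (f := a) (fun i hi => ha0 i (by rw [mem_range] at hi; omega))
      (mem_range.2 (Nat.lt_succ_of_le hj))
  have hB : ∀ j ≤ p, b j ≤ ∑ i ∈ range (p + 1), b i := fun j hj =>
    single_le_sum (f := b) (fun i hi => hb0 i (by rw [mem_range] at hi; omega))
      (mem_range.2 (Nat.lt_succ_of_le hj))
  have hAnn : 0 ≤ ∑ i ∈ range (p + 1), a i :=
    sum_nonneg fun i hi => ha0 i (by rw [mem_range] at hi; omega)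
  have hBnn : 0 ≤ ∑ j ∈ range (p + 1), b j :=
    sum_nonneg fun j hj => hb0 j (by rw [mem_range] at hj; omega)
  -- first product `(∂_r F) · G`: split off the term `q = p` (top radial order)
  have hI : ‖iteratedFDeriv ℝ p (fun y => fderiv ℝ F y u * G y) x‖ ≤
      ar p * b 0 + 2 ^ p * ((∑ i ∈ range (p + 1), a i) * ∑ j ∈ range (p + 1), b j) := by
    have hterm : ∀ k ∈ range (p + 1), (p.choose k : ℝ) *
        ‖iteratedFDeriv ℝ k (fun y => fderiv ℝ F y u) x‖ * ‖iteratedFDeriv ℝ (p - k) G x‖ ≤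
        (if k = p then ar p * b 0 else 2 ^ p * (a (k + 1) * ∑ j ∈ range (p + 1), b j)) := by
      intro k hk
      rw [mem_range] at hk
      by_cases hkp : k = p
      · subst hkp
        rw [if_pos rfl, Nat.choose_self, Nat.cast_one, one_mul]
        calc ‖iteratedFDeriv ℝ k (fun y => fderiv ℝ F y u) x‖ * ‖iteratedFDeriv ℝ (k - k) G x‖
            ≤ ar k * b (k - k) :=
              mul_le_mul (har _ le_rfl x) (hb _ (by omega) x) (norm_nonneg _) (har0 _ le_rfl)
          _ = ar k * b 0 := by rw [Nat.sub_self]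
      · rw [if_neg hkp]
        have hchoose : (p.choose k : ℝ) ≤ 2 ^ p := by exact_mod_cast Nat.choose_le_two_pow p k
        calc (p.choose k : ℝ) * ‖iteratedFDeriv ℝ k (fun y => fderiv ℝ F y u) x‖ *
              ‖iteratedFDeriv ℝ (p - k) G x‖
            ≤ 2 ^ p * a (k + 1) * ∑ j ∈ range (p + 1), b j := by
              gcongr
              · exact mul_nonneg (by positivity) (ha0 _ (by omega))
              · exact (har _ (by omega) x).trans (har' _ (by omega))
              · exact (hb _ (by omega) x).trans (hB _ (by omega))
          _ = 2 ^ p * (a (k + 1) * ∑ j ∈ range (p + 1), b j) := by ring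
    refine ((norm_iteratedFDeriv_mul_le hdF hG' x (n := p) (by exact_mod_cast le_rfl)).trans
      (sum_le_sum hterm)).trans ?_
    rw [sum_range_succ, if_pos rfl]
    rw [sum_congr rfl (g := fun k => 2 ^ p * (a (k + 1) * ∑ j ∈ range (p + 1), b j))
      (fun k hk => by rw [mem_range] at hk; rw [if_neg (by omega)])]
    rw [← mul_sum, ← sum_mul]
    have h3 : ∑ i ∈ range (p + 1), a i = ∑ k ∈ range p, a (k + 1) + a 0 := sum_range_succ' a p
    have h4 : (∑ k ∈ range p, a (k + 1)) * ∑ j ∈ range (p + 1), b j ≤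
        (∑ i ∈ range (p + 1), a i) * ∑ j ∈ range (p + 1), b j := by
      rw [h3]
      exact mul_le_mul_of_nonneg_right (by linarith [ha0 0 (by omega)]) hBnn
    nlinarith [pow_pos (by norm_num : (0 : ℝ) < 2) p]
  -- second product `F · (∂_r G)`: split off the term `q = 0`
  have hII : ‖iteratedFDeriv ℝ p (fun y => F y * fderiv ℝ G y u) x‖ ≤
      a 0 * br p + 2 ^ p * ((∑ i ∈ range (p + 1), a i) * ∑ j ∈ range (p + 1), b j) := by
    have hterm : ∀ k ∈ range (p + 1), (p.choose k : ℝ) *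
        ‖iteratedFDeriv ℝ k F x‖ * ‖iteratedFDeriv ℝ (p - k) (fun y => fderiv ℝ G y u) x‖ ≤
        (if k = 0 then a 0 * br p else 2 ^ p * (a k * ∑ j ∈ range (p + 1), b j)) := by
      intro k hk
      rw [mem_range] at hk
      rcases Nat.eq_zero_or_pos k with rfl | hk0
      · rw [if_pos rfl, Nat.choose_zero_right, Nat.cast_one, one_mul]
        exact mul_le_mul (ha 0 (by omega) x) (hbr p le_rfl x) (norm_nonneg _) (ha0 0 (by omega))
      · rw [if_neg hk0.ne']
        have hchoose : (p.choose k : ℝ) ≤ 2 ^ p := by exact_mod_cast Nat.choose_le_two_pow p k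
        calc (p.choose k : ℝ) * ‖iteratedFDeriv ℝ k F x‖ *
              ‖iteratedFDeriv ℝ (p - k) (fun y => fderiv ℝ G y u) x‖
            ≤ 2 ^ p * a k * ∑ j ∈ range (p + 1), b j := by
              gcongr
              · exact mul_nonneg (by positivity) (ha0 _ (by omega))
              · exact ha _ (by omega) x
              · exact ((hbr _ (by omega) x).trans (hbr' _ (by omega))).trans (hB _ (by omega))
          _ = 2 ^ p * (a k * ∑ j ∈ range (p + 1), b j) := by ring
    refine ((norm_iteratedFDeriv_mul_le hF' hdG x (n := p) (by exact_mod_cast le_rfl)).trans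
      (sum_le_sum hterm)).trans ?_
    rw [sum_range_succ', if_pos rfl]
    rw [sum_congr rfl (g := fun k => 2 ^ p * (a (k + 1) * ∑ j ∈ range (p + 1), b j))
      (fun k hk => by rw [if_neg (Nat.succ_ne_zero k)])]
    rw [← mul_sum, ← sum_mul]
    have h3 : ∑ i ∈ range (p + 1), a i = ∑ k ∈ range p, a (k + 1) + a 0 := sum_range_succ' a p
    have h4 : (∑ k ∈ range p, a (k + 1)) * ∑ j ∈ range (p + 1), b j ≤
        (∑ i ∈ range (p + 1), a i) * ∑ j ∈ range (p + 1), b j := by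
      rw [h3]
      exact mul_le_mul_of_nonneg_right (by linarith [ha0 0 (by omega)]) hBnn
    nlinarith [pow_pos (by norm_num : (0 : ℝ) < 2) p]
  have e1 : (2 : ℝ) ^ (p + 1) = 2 * 2 ^ p := by ring
  rw [e1]
  linarith

/-- **Lemma 3 (iv)** (p.6:L183–189):
"`|FG|_{p+1,r} ≤ 2^{p+2}|F|_p|G|_p + ‖∂_rF‖_p‖G‖₀ + ‖F‖₀‖∂_rG‖_p ≤ 2^{p+2}(|F|_{p+1,r}|G|_p + |F|_p|G|_{p+1,r})`",
with `|H|_{p+1,r} = |H|_p + ‖∂_r H‖_p`: at every point, for the profiles of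
`norm_iteratedFDeriv_radialDeriv_mul_le` (writing `A = Σ_{i≤p} a i = |F|_p`, `B = Σ_{j≤p} b j = |G|_p`),
`Σ_{n≤p} ‖D^n(FG)(x)‖ + ‖D^p ∂_r(FG)(x)‖ ≤ 2^{p+2} A B + ar_p b₀ + a₀ br_p ≤ 2^{p+2}((A + ar_p) B + A (B + br_p))`.
[cite: FeldmanSalmhoferTrubowitz2000, Lemma 3 (iv) §2.2 p.6:L183-189; proof p.6:L195-207, p.7:L1-5] -/
theorem radialNorm_mul_le {F G : X → 𝔸} {p : ℕ} {u : X}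
    (hF : ContDiff ℝ (p + 1) F) (hG : ContDiff ℝ (p + 1) G) {a b ar br : ℕ → ℝ}
    (ha : ∀ j ≤ p, ∀ x, ‖iteratedFDeriv ℝ j F x‖ ≤ a j)
    (hb : ∀ j ≤ p, ∀ x, ‖iteratedFDeriv ℝ j G x‖ ≤ b j)
    (har : ∀ j ≤ p, ∀ x, ‖iteratedFDeriv ℝ j (fun y => fderiv ℝ F y u) x‖ ≤ ar j)
    (hbr : ∀ j ≤ p, ∀ x, ‖iteratedFDeriv ℝ j (fun y => fderiv ℝ G y u) x‖ ≤ br j)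
    (har' : ∀ j < p, ar j ≤ a (j + 1)) (hbr' : ∀ j < p, br j ≤ b (j + 1)) (x : X) :
    (∑ n ∈ range (p + 1), ‖iteratedFDeriv ℝ n (fun y => F y * G y) x‖) +
        ‖iteratedFDeriv ℝ p (fun y => fderiv ℝ (fun z => F z * G z) y u) x‖ ≤
      2 ^ (p + 2) * ((∑ i ∈ range (p + 1), a i) * ∑ j ∈ range (p + 1), b j) +
        ar p * b 0 + a 0 * br p ∧
    2 ^ (p + 2) * ((∑ i ∈ range (p + 1), a i) * ∑ j ∈ range (p + 1), b j) +
        ar p * b 0 + a 0 * br p ≤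
      2 ^ (p + 2) * (((∑ i ∈ range (p + 1), a i) + ar p) * (∑ j ∈ range (p + 1), b j) +
        (∑ i ∈ range (p + 1), a i) * ((∑ j ∈ range (p + 1), b j) + br p)) := by
  have hp1 : (p : WithTop ℕ∞) ≤ (p + 1 : ℕ) := by exact_mod_cast Nat.le_succ p
  have hlow := sum_norm_iteratedFDeriv_mul_le (hF.of_le hp1) (hG.of_le hp1) ha hb x
  have hrad := norm_iteratedFDeriv_radialDeriv_mul_le hF hG ha hb har hbr har' hbr' x
  have ha0 : ∀ i ≤ p, 0 ≤ a i := fun i hi => (norm_nonneg _).trans (ha i hi x)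
  have hb0 : ∀ j ≤ p, 0 ≤ b j := fun j hj => (norm_nonneg _).trans (hb j hj x)
  have har0 : 0 ≤ ar p := (norm_nonneg _).trans (har p le_rfl x)
  have hbr0 : 0 ≤ br p := (norm_nonneg _).trans (hbr p le_rfl x)
  have hA : a 0 ≤ ∑ i ∈ range (p + 1), a i :=
    single_le_sum (f := a) (fun i hi => ha0 i (by rw [mem_range] at hi; omega))
      (mem_range.2 (Nat.succ_pos p))
  have hB : b 0 ≤ ∑ i ∈ range (p + 1), b i :=
    single_le_sum (f := b) (fun i hi => hb0 i (by rw [mem_range] at hi; omega))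
      (mem_range.2 (Nat.succ_pos p))
  have hAnn : 0 ≤ ∑ i ∈ range (p + 1), a i :=
    sum_nonneg fun i hi => ha0 i (by rw [mem_range] at hi; omega)
  have hBnn : 0 ≤ ∑ j ∈ range (p + 1), b j :=
    sum_nonneg fun j hj => hb0 j (by rw [mem_range] at hj; omega)
  have h2p : (1 : ℝ) ≤ 2 ^ (p + 2) := one_le_pow₀ (by norm_num)
  have e1 : (2 : ℝ) ^ (p + 1) = 2 * 2 ^ p := by ring
  have e2 : (2 : ℝ) ^ (p + 2) = 4 * 2 ^ p := by ring
  refine ⟨?_, ?_⟩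
  · rw [e1] at hrad
    rw [e2]
    nlinarith [mul_nonneg hAnn hBnn, pow_pos (by norm_num : (0 : ℝ) < 2) p]
  · set A := ∑ i ∈ range (p + 1), a i with hAdef
    set B := ∑ j ∈ range (p + 1), b j with hBdef
    have h5 : ar p * b 0 ≤ 2 ^ (p + 2) * (ar p * B) := by
      calc ar p * b 0 ≤ 1 * (ar p * B) := by
            rw [one_mul]; exact mul_le_mul_of_nonneg_left hB har0
        _ ≤ 2 ^ (p + 2) * (ar p * B) :=
            mul_le_mul_of_nonneg_right h2p (mul_nonneg har0 hBnn)
    have h6 : a 0 * br p ≤ 2 ^ (p + 2) * (A * br p) := by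
      calc a 0 * br p ≤ 1 * (A * br p) := by
            rw [one_mul]; exact mul_le_mul_of_nonneg_right hA hbr0
        _ ≤ 2 ^ (p + 2) * (A * br p) :=
            mul_le_mul_of_nonneg_right h2p (mul_nonneg hAnn hbr0)
    have h7 : 0 ≤ 2 ^ (p + 2) * (A * B) :=
      mul_nonneg (pow_nonneg (by norm_num) _) (mul_nonneg hAnn hBnn)
    have expand : 2 ^ (p + 2) * ((A + ar p) * B + A * (B + br p)) =
        2 ^ (p + 2) * (A * B) + 2 ^ (p + 2) * (ar p * B) +
          (2 ^ (p + 2) * (A * B) + 2 ^ (p + 2) * (A * br p)) := by ring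
    rw [expand]
    linarith

end FST4

end Literature.MathematicalPhysics.QuantumLattice.FermiRG
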